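import Literature.Geometry.Lorentzian.CoordShrinkerRicciPinching
import Literature.Geometry.Lorentzian.CoordCurvatureNormSq
import HarnessLib

/-!
# Munteanu–Wang 2015, Thm. 1.4 at a point: the drift Laplacian of
# `v = √(|Rm|² + 1) + |Ric|²` on a four-dimensional gradient shrinker, in coordinates

Pointwise coordinate computation (metric components `G : E → (E →L E →L ℝ)` on an open `V`,
`MetricCoord.IsMetricOn G V`, positive definite at the point `x`) behind the last step of the proof of
**Munteanu–Wang 2015, Thm. 1.4** ("a four dimensional shrinking gradient Ricci soliton with bounded
scalar curvature has bounded curvature", p. 6 of the arXiv text: "`Δ_f |Rm| ≥ −c|Rm|²`" and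
"`v := |Rm| + |Ric|²` satisfies `Δ_f v ≥ ½ v² − c`"), in the variant with the smooth function
`√(|Rm|² + 1)` in place of `|Rm|` (so that no regularisation at the zeros of `Rm` is needed):

* `lapAt_sub_fderiv_comp_add` — the expansion of `Δ(φ(S) + R) − d(φ(S) + R)(W)` (linearity
  `lapAt_add`, local chain rule `lapAt_comp_of_contDiffAt`);
* `mw_rho_drift_ge`, `mw_rm_drift_arith` — the real arithmetic of the proof (p. 6): with
  `ρ = √(|Rm|² + 1)`, `Δ_f ρ ≥ −C ρ²` from `Δ_f |Rm|² ≥ 2N − C(|Rm| + 1)|Rm|²`, `|∇|Rm|²|² ≤ 4|Rm|² N`;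
  then `Δ_f(ρ + |Ric|²) ≥ ¼(ρ + |Ric|²)² − K` from (1.10), Prop. 1.1 with `|∇f|² ≥ 32(C + 1)` and the
  Ricci bound `|Ric|² ≤ B`, with the explicit constant `K = (C + 1)(16B + 1) + 9B²`;
* `IsMetricOn.mw_drift_sqrt_rmNormSqAt_add_normSqAt_ricAt` — **the pointwise drift inequality**:
  GIVEN at `x` (i) `|∇f|²|Rm|² ≤ 16|∇f|²|Ric|² + 64|∇Ric|²` (Prop. 1.1, file
  `CoordShrinkerCurvatureGradientBound`), (ii) `Δ_f|Ric|² ≥ 2|∇Ric|² + 2|Ric|² − 4|Rm||Ric|²` ((1.10),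
  file `CoordShrinkerRicciNormSqDrift`), (iii) the `|Rm|²` drift inequality
  `∃ N ≥ 0, Δ_f|Rm|² ≥ 2N − C₅(|Rm| + 1)|Rm|², |∇|Rm|²|² ≤ 4|Rm|²N` (the soliton identity
  `Δ_f Rm = Rm + Rm ∗ Rm` with Kato), and the bounds `|Ric|² ≤ B`, `|∇f|² ≥ 32(C₅ + 1)`: for
  `v = √(|Rm|² + 1) + |Ric|²`, `Δ_G v − dv(∇f) ≥ ¼ v² − ((C₅ + 1)(16B + 1) + 9B²)`.
  The three inputs are taken as hypotheses here (they are proved in the sibling files), so that this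
  file only depends on the coordinate calculus already in the tree; in particular neither the soliton
  equation nor any property of `f` is used beyond the displayed inputs.

First user: the boundedness of `|Rm|` on complete four-dimensional gradient shrinkers with bounded
scalar curvature (Munteanu–Wang 2015, Thm. 1.4), step 1 of the printed chain behind the named fact
`shrinkerSplittingAtInfinity_four` (crux `EntropyRung.NoncompactShrinkerGap`, SmoothPoincare4).
Everything is proved; no definition and no statement of `Prop` type is introduced.

## References

* O. Munteanu, J. Wang, *Geometry of shrinking Ricci solitons*, Compositio Math. 151 (2015)
  2273–2300 = arXiv:1410.3813, §1: Prop. 1.1 (p. 4), Lemma 1.2 with (1.10) (p. 5), Thm. 1.4 and its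
  proof (p. 6): "`Δ_f|Rm| ≥ −c|Rm|²`", "`v := |Rm| + |Ric|²` satisfies `Δ_f v ≥ ½v² − c`". READ (arXiv
  text). [MunteanuWang2015]
* B. O'Neill, *Semi-Riemannian geometry with applications to relativity*, Academic Press 1983, Ch. 3,
  pp. 60–61, Def. 3.50 (the chain rule for the Laplacian). [ONeill1983]
-/

noncomputable section

set_option maxSynthPendingDepth 3

open Set Filter ContinuousLinearMap Module
open scoped Topology ContDiff

namespace Literature.Geometry.Lorentzian

namespace MetricCoord

variable {E : Type*} [NormedAddCommGroup E] [NormedSpace ℝ E] [FiniteDimensional ℝ E]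
  {G : E → E →L[ℝ] E →L[ℝ] ℝ} {V : Set E} {x : E}

/-! ### The drift Laplacian of a sum `φ(S) + R` -/

/-- **`Δ(φ(S) + R) − d(φ(S) + R)(W)` expanded**: for `R`, `S` of class `C²` at `x` and a profile `φ`
of class `C²` at `S x`,
`Δ_G(φ(S) + R) − d(φ(S) + R)(W) = φ'(S)(Δ_G S − dS(W)) + φ''(S)|∇S|² + (Δ_G R − dR(W))`
(linearity `lapAt_add`, chain rule `lapAt_comp_of_contDiffAt`). With `W = ∇f`, `φ(t) = √(t+1)`,
`S = |Rm|²`, `R = |Ric|²` this is the expansion of `Δ_f v` in the proof of Munteanu–Wang 2015,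
Thm. 1.4. [folklore] -/
theorem lapAt_sub_fderiv_comp_add {R S : E → ℝ} (hR : ContDiffAt ℝ 2 R x) (hS : ContDiffAt ℝ 2 S x)
    {φ : ℝ → ℝ} (hφ : ContDiffAt ℝ 2 φ (S x)) (W : E) :
    lapAt G (fun y ↦ φ (S y) + R y) x - fderiv ℝ (fun y ↦ φ (S y) + R y) x W =
      deriv φ (S x) * (lapAt G S x - fderiv ℝ S x W) + deriv (deriv φ) (S x) * gradSqAt G S x
        + (lapAt G R x - fderiv ℝ R x W) := by
  have hψ : ContDiffAt ℝ 2 (fun y ↦ φ (S y)) x := hφ.comp x hS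
  have hRd : DifferentiableAt ℝ R x := hR.differentiableAt (by simp)
  have hSd : DifferentiableAt ℝ S x := hS.differentiableAt (by simp)
  have hφd : DifferentiableAt ℝ φ (S x) := hφ.differentiableAt (by simp)
  have hψd : DifferentiableAt ℝ (fun y ↦ φ (S y)) x := hψ.differentiableAt (by simp)
  rw [lapAt_add G hψ hR, lapAt_comp_of_contDiffAt hφ hS, fderiv_fun_add hψd hRd,
    fderiv_comp_eq_of_differentiableAt hφd hSd]
  simp only [_root_.add_apply, FunLike.coe_smul, Pi.smul_apply, smul_eq_mul]
  ring

/-! ### Real-variable lemmas (the arithmetic of the proof of Munteanu–Wang's Thm. 1.4) -/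

section Real

/-- **`Δ_f ρ ≥ −C ρ²` for `ρ = √(|Rm|² + 1)`**: with `M = |Rm|² ≥ 0`, `ρ² = M + 1`, `m = √M`,
from `Δ_f M ≥ 2N − C(m + 1)M`, `|∇M|² ≤ 4MN`, `N ≥ 0`, and the chain rule
`Δ_f ρ = ½(M+1)^{-1/2} Δ_f M − ¼(M+1)^{-3/2}|∇M|²` (written with `(M+1)^{-1/2} = ρ/(M+1)`,
`(M+1)^{-3/2} = ρ/(M+1)²`): `Δ_f ρ ≥ N(ρ² − M)/ρ³ − C(m+1)M/(2ρ) ≥ −Cρ²` (`m + 1 ≤ 2ρ`, `M ≤ ρ²`).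
[cite: MunteanuWang2015, Thm. 1.4 (proof)] -/
theorem mw_rho_drift_ge {M ρ m C N LM gM : ℝ} (hM0 : 0 ≤ M) (hρ0 : 0 < ρ) (hρ2 : ρ ^ 2 = M + 1)
    (hm2 : m ^ 2 = M) (hC : 0 ≤ C) (hN0 : 0 ≤ N) (hN1 : 2 * N - C * (m + 1) * M ≤ LM)
    (hN2 : gM ≤ 4 * M * N) :
    -(C * ρ ^ 2) ≤ 1 / 2 * (ρ / (M + 1)) * LM + -(1 / 4) * (ρ / (M + 1) ^ 2) * gM := by
  have hmρ : m ≤ ρ := (abs_le_of_sq_le_sq' (by rw [hm2, hρ2]; linarith) hρ0.le).2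
  have h1ρ : 1 ≤ ρ := (abs_le_of_sq_le_sq' (by rw [one_pow, hρ2]; linarith) hρ0.le).2
  have e1 : ρ / (M + 1) = 1 / ρ := by rw [← hρ2, sq, ← div_div, div_self hρ0.ne']
  have e2 : ρ / (M + 1) ^ 2 = 1 / ρ ^ 3 := by
    rw [← hρ2, div_eq_div_iff (by positivity) (by positivity)]
    ring
  rw [e1, e2]
  have h1 : 1 / 2 * (1 / ρ) * (2 * N - C * (m + 1) * M) ≤ 1 / 2 * (1 / ρ) * LM :=
    mul_le_mul_of_nonneg_left hN1 (by positivity)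
  have h2 : 1 / 4 * (1 / ρ ^ 3) * gM ≤ 1 / 4 * (1 / ρ ^ 3) * (4 * M * N) :=
    mul_le_mul_of_nonneg_left hN2 (by positivity)
  have hprod : 1 / 2 * (m + 1) * M ≤ ρ * ρ ^ 2 :=
    mul_le_mul (by linarith) (by linarith) hM0 hρ0.le
  have hkey : -(C * ρ ^ 2) ≤
      1 / 2 * (1 / ρ) * (2 * N - C * (m + 1) * M) - 1 / 4 * (1 / ρ ^ 3) * (4 * M * N) := by
    have hid : 1 / 2 * (1 / ρ) * (2 * N - C * (m + 1) * M) - 1 / 4 * (1 / ρ ^ 3) * (4 * M * N) =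
        (N * (ρ ^ 2 - M) - C * (1 / 2 * (m + 1) * M) * ρ ^ 2) / ρ ^ 3 := by
      field_simp
      ring
    rw [hid, le_div_iff₀ (by positivity)]
    have h3 : C * (1 / 2 * (m + 1) * M) * ρ ^ 2 ≤ C * (ρ * ρ ^ 2) * ρ ^ 2 :=
      mul_le_mul_of_nonneg_right (mul_le_mul_of_nonneg_left hprod hC) (by positivity)
    have h4 : ρ ^ 2 - M = 1 := by linarith
    rw [h4]
    linarith [h3, hN0]
  linarith [hkey, h1, h2]

/-- **The arithmetic of the proof of Thm. 1.4** for `v = ρ + R` (`ρ = √(|Rm|²+1)`, `R = |Ric|²`,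
`m = |Rm|`, `M = |Rm|²`, `D = |∇Ric|²`, `q = |∇f|²`): from `Δ_f ρ ≥ −Cρ²`, (1.10)
`Δ_f R ≥ 2D + 2R − 4mR`, Prop. 1.1 `qM ≤ 16qR + 64D`, `0 ≤ R ≤ B` and `q ≥ 32(C+1)` one gets
`Δ_f v ≥ ½ρ² − (C+1)(16B+1) − 8B² ≥ ¼v² − ((C+1)(16B+1) + 9B²)` (case distinction
`ρ² ≥ 16B + 1` or not; `4ρB ≤ ½ρ² + 8B²`, `v² ≤ 2ρ² + 2B²`). [cite: MunteanuWang2015, Thm. 1.4 (proof)] -/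
theorem mw_rm_drift_arith {M ρ m R B C D q LR A drift : ℝ} (hρ0 : 0 < ρ) (hρ2 : ρ ^ 2 = M + 1)
    (hm2 : m ^ 2 = M) (hR0 : 0 ≤ R) (hRB : R ≤ B) (hB : 0 ≤ B) (hC : 0 ≤ C) (hD0 : 0 ≤ D)
    (hq : 32 * (C + 1) ≤ q) (hP : q * M ≤ 16 * q * R + 64 * D)
    (hL : 2 * D + 2 * R - 4 * m * R ≤ LR) (hA : -(C * ρ ^ 2) ≤ A) (hdrift : drift = A + LR) :
    1 / 4 * (ρ + R) ^ 2 - ((C + 1) * (16 * B + 1) + 9 * B ^ 2) ≤ drift := by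
  have hmρ : m ≤ ρ := (abs_le_of_sq_le_sq' (by rw [hm2, hρ2]; linarith) hρ0.le).2
  have hmR : m * R ≤ ρ * B := mul_le_mul hmρ hRB hR0 hρ0.le
  have hLR : 2 * D - 4 * (ρ * B) ≤ LR := by linarith [hL, hmR, hR0]
  have hq0 : 0 ≤ q := by linarith
  have hqR : q * R ≤ q * B := mul_le_mul_of_nonneg_left hRB hq0
  have hM : M = ρ ^ 2 - 1 := by linarith
  rw [hM] at hP
  have hD : q * (ρ ^ 2 - 1 - 16 * B) ≤ 64 * D := by linarith [hP, hqR]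
  -- the common lower bound `Δ_f v ≥ ½ρ² − (C+1)(16B+1) − 8B²`
  have hcommon : 1 / 2 * ρ ^ 2 - (C + 1) * (16 * B + 1) - 8 * B ^ 2 ≤ A + LR := by
    have hsq : 4 * (ρ * B) ≤ 1 / 2 * ρ ^ 2 + 8 * B ^ 2 := by nlinarith [sq_nonneg (ρ - 4 * B)]
    rcases le_or_gt (16 * B + 1) (ρ ^ 2) with hcase | hcase
    · have h1 : 32 * (C + 1) * (ρ ^ 2 - 1 - 16 * B) ≤ q * (ρ ^ 2 - 1 - 16 * B) :=
        mul_le_mul_of_nonneg_right hq (by linarith)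
      linarith [h1, hD, hLR, hA, hsq]
    · have h2 : C * ρ ^ 2 ≤ C * (16 * B + 1) := mul_le_mul_of_nonneg_left hcase.le hC
      linarith [h2, hD0, hLR, hA, hsq]
  -- `¼ v² ≤ ½ ρ² + ½ B²`
  have hv : 1 / 4 * (ρ + R) ^ 2 ≤ 1 / 2 * ρ ^ 2 + 1 / 2 * B ^ 2 := by
    nlinarith [mul_le_mul hRB hRB hR0 hB, mul_le_mul_of_nonneg_left hRB hρ0.le, sq_nonneg (ρ - B)]
  rw [hdrift]
  nlinarith [hcommon, hv, sq_nonneg B]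

end Real

/-! ### Munteanu–Wang's Thm. 1.4 at a point, for `v = √(|Rm|² + 1) + |Ric|²` -/

variable [CompleteSpace E]

/-- **The drift inequality for `v = √(|Rm|² + 1) + |Ric|²` on a four-dimensional gradient shrinker,
in coordinates** (Munteanu–Wang 2015, proof of Thm. 1.4, with `|Rm|` replaced by the smooth
`√(|Rm|² + 1)` and all constants explicit): at a positive definite point `x ∈ V` of metric components
`G`, GIVEN at `x` the three pointwise inputs (i) `|∇f|² |Rm|² ≤ 16 |∇f|² |Ric|² + 64 |∇Ric|²`
(Prop. 1.1), (ii) `Δ_f |Ric|² ≥ 2|∇Ric|² + 2|Ric|² − 4|Rm| |Ric|²` ((1.10)) — with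
`|∇Ric|² = Σ g^{kl}⟨∇_kRic, ∇_lRic⟩` in a basis `b` — and (iii)
`∃ N ≥ 0, Δ_f |Rm|² ≥ 2N − C₅(|Rm| + 1)|Rm|², |∇|Rm|²|² ≤ 4|Rm|² N` (from `Δ_f Rm = Rm + Rm ∗ Rm`),
together with `0 ≤ C₅`, `0 ≤ B`, `|Ric|² ≤ B` and `|∇f|² ≥ 32(C₅ + 1)`, one has
`Δ_G v − dv(♯df) ≥ ¼ v² − ((C₅ + 1)(16B + 1) + 9B²)` (`Δ_f = Δ_G − ⟨∇f, ∇·⟩`).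
[cite: MunteanuWang2015, Thm. 1.4 (proof)] -/
theorem IsMetricOn.mw_drift_sqrt_rmNormSqAt_add_normSqAt_ricAt (hG : IsMetricOn G V) (hx : x ∈ V)
    (hpos : ∀ v : E, v ≠ 0 → 0 < G x v v) (f : E → ℝ) {ι : Type*} [Fintype ι] (b : Basis ι ℝ E)
    {C₅ B : ℝ} (hC : 0 ≤ C₅) (hB : 0 ≤ B) (hRB : normSqAt G x (ricAt G x) ≤ B)
    (hq : 32 * (C₅ + 1) ≤ gradSqAt G f x)
    (hP : gradSqAt G f x * rmNormSqAt G x ≤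
      16 * gradSqAt G f x * normSqAt G x (ricAt G x)
        + 64 * ∑ k, ∑ l, ginv G b x k l *
            pairAt G x (cov₂At G (ricAt G) x (b k)) (cov₂At G (ricAt G) x (b l)))
    (hL : 2 * (∑ k, ∑ l, ginv G b x k l *
            pairAt G x (cov₂At G (ricAt G) x (b k)) (cov₂At G (ricAt G) x (b l)))
        + 2 * normSqAt G x (ricAt G x)
        - 4 * Real.sqrt (rmNormSqAt G x) * normSqAt G x (ricAt G x) ≤
      lapAt G (fun y ↦ normSqAt G y (ricAt G y)) x
        - fderiv ℝ (fun y ↦ normSqAt G y (ricAt G y)) x (sharpAt G x (fderiv ℝ f x)))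
    (hN : ∃ N : ℝ, 0 ≤ N ∧
      2 * N - C₅ * (Real.sqrt (rmNormSqAt G x) + 1) * rmNormSqAt G x ≤
          lapAt G (rmNormSqAt G) x - fderiv ℝ (rmNormSqAt G) x (sharpAt G x (fderiv ℝ f x)) ∧
        gradSqAt G (rmNormSqAt G) x ≤ 4 * rmNormSqAt G x * N) :
    1 / 4 * ((rmNormSqAt G x + 1) ^ (1 / 2 : ℝ) + normSqAt G x (ricAt G x)) ^ 2
        - ((C₅ + 1) * (16 * B + 1) + 9 * B ^ 2) ≤
      lapAt G (fun y ↦ (rmNormSqAt G y + 1) ^ (1 / 2 : ℝ) + normSqAt G y (ricAt G y)) x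
        - fderiv ℝ (fun y ↦ (rmNormSqAt G y + 1) ^ (1 / 2 : ℝ) + normSqAt G y (ricAt G y)) x
            (sharpAt G x (fderiv ℝ f x)) := by
  -- ### names and signs
  set Rc : E → ℝ := fun y ↦ normSqAt G y (ricAt G y) with hRcdef
  set W : E := sharpAt G x (fderiv ℝ f x) with hWdef
  obtain ⟨N, hN0, hN1, hN2⟩ := hN
  have hsymV : ∀ y ∈ V, ∀ v w, ricAt G y v w = ricAt G y w v := fun y hy ↦ hG.ricAt_comm hy
  have hR0 : 0 ≤ normSqAt G x (ricAt G x) := hG.normSqAt_nonneg_of_symm hx hpos (hsymV x hx)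
  have hD0 : 0 ≤ ∑ k, ∑ l, ginv G b x k l *
      pairAt G x (cov₂At G (ricAt G) x (b k)) (cov₂At G (ricAt G) x (b l)) :=
    hG.covNormSq_nonneg b hx hpos hG.contDiffOn_ricAt hsymV
  obtain ⟨e, he⟩ := exists_orthonormal_basis (hG.symm x hx) hpos
  have hM0 : 0 ≤ rmNormSqAt G x := hG.rmNormSqAt_nonneg e he hx
  have hσpos : 0 < rmNormSqAt G x + 1 := by linarith
  -- ### the value `ρ = (|Rm|² + 1)^{1/2}`
  set ρ : ℝ := (rmNormSqAt G x + 1) ^ (1 / 2 : ℝ) with hρdef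
  have hρ0 : 0 < ρ := Real.rpow_pos_of_pos hσpos _
  have hρ2 : ρ ^ 2 = rmNormSqAt G x + 1 := by
    rw [hρdef, ← Real.sqrt_eq_rpow, Real.sq_sqrt hσpos.le]
  -- ### regularity and the expansion
  have hRc2 : ContDiffAt ℝ 2 Rc x := (hG.contDiffAt_normSqAt_ricAt hx).of_le (by norm_cast)
  have hM2 : ContDiffAt ℝ 2 (rmNormSqAt G) x :=
    ((hG.contDiffOn_rmNormSqAt x hx).contDiffAt (hG.mem_nhds hx)).of_le (by norm_cast)
  have hφ : ContDiffAt ℝ 2 (fun s : ℝ ↦ (s + 1) ^ (1 / 2 : ℝ)) (rmNormSqAt G x) :=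
    contDiffAt_profile _ hσpos
  have hexp := lapAt_sub_fderiv_comp_add (G := G) hRc2 hM2 hφ W
  have hd1 : deriv (fun s : ℝ ↦ (s + 1) ^ (1 / 2 : ℝ)) (rmNormSqAt G x) =
      1 / 2 * (ρ / (rmNormSqAt G x + 1)) := by
    rw [deriv_profile _ hσpos, Real.rpow_sub_one hσpos.ne', hρdef]
  have hdd2 : deriv (deriv fun s : ℝ ↦ (s + 1) ^ (1 / 2 : ℝ)) (rmNormSqAt G x) =
      -(1 / 4) * (ρ / (rmNormSqAt G x + 1) ^ 2) := by
    rw [deriv_deriv_profile _ hσpos, Real.rpow_sub hσpos, Real.rpow_two, hρdef]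
    ring
  have hdrift : lapAt G (fun y ↦ (rmNormSqAt G y + 1) ^ (1 / 2 : ℝ) + Rc y) x
        - fderiv ℝ (fun y ↦ (rmNormSqAt G y + 1) ^ (1 / 2 : ℝ) + Rc y) x W =
      1 / 2 * (ρ / (rmNormSqAt G x + 1)) * (lapAt G (rmNormSqAt G) x - fderiv ℝ (rmNormSqAt G) x W)
          + -(1 / 4) * (ρ / (rmNormSqAt G x + 1) ^ 2) * gradSqAt G (rmNormSqAt G) x
        + (lapAt G Rc x - fderiv ℝ Rc x W) := by
    rw [hexp, hd1, hdd2]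
  -- ### the real-variable lemmas
  have hA := mw_rho_drift_ge hM0 hρ0 hρ2 (Real.sq_sqrt hM0) hC hN0 hN1 hN2
  exact mw_rm_drift_arith hρ0 hρ2 (Real.sq_sqrt hM0) hR0 hRB hB hC hD0 hq hP hL hA hdrift

end MetricCoord

end Literature.Geometry.Lorentzian

end
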